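import Summits.CriticalPhenomena.CardyFormulaZ2.Theorems.CardyWickAnisotropyBoxFamilyToCardyKnownHalf
import Literature.Probability.Percolation.IsoradialRectangularCrossingsSS
import Literature.Probability.Percolation.IsoradialRectangularCrossingsOfSSFact
import HarnessLib

/-!
# Crux `BoxFamilyToCardy` (stmt-CriticalPhenomena-14215): the known half from the PRINTED DKKMO Thm 2.1

Route `CardyWickAnisotropy` of `CardyFormulaZ2`, crux `BoxFamilyToCardy : AnisotropicBoxCardy →
CardyFormulaZ2` (line `Cruxes/BoxFamilyToCardy/Lines/birth.lean`). Sequel of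
`CardyWickAnisotropyBoxFamilyToCardyKnownHalf.lean` (lead c1: `isotropicRectangles_of_thm21 :
DKKMO2020_thm21_quadCrossingProb → AnisotropicBoxCardy → RectCardy`), recording the reshape of the
known-half stub by lead c2 (2026-08-17): the per-quad reading `DKKMO2020_thm21_quadCrossingProb` of
Duminil-Copin–Kozlowski–Krachun–Manolescu–Oulamara, arXiv:2012.11672v1, Thm. 2.1 (`q = 1`) is now a
tree THEOREM modulo the printed coupling statement of that theorem — its Schramm–Smirnov half, the
named fact `Literature.Probability.Percolation.DKKMO2020_thm21_schrammSmirnov`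
(`IsoradialRectangularCrossingsSS.lean`) — by
`DKKMO2020_thm21_quadCrossingProb_of_thm21_schrammSmirnov` (`IsoradialRectangularCrossingsOfSSFact.lean`,
over `…_of_schrammSmirnov'` of `IsoradialRectangularCrossingsOfSS.lean`:
Schramm–Smirnov's Lemma 5.1, discharged in the tree, reads the coupling on each quad, exactly as
§7.1 p. 43 of the paper does for Cor. 1.3). Consequently:

* `isotropicRectangles_of_thm21SS` — **the known half from the printed fact**: Cardy along the
  anisotropic box family (`AnisotropicBoxCardy`, the route's target `X_A`) implies Cardy for every
  corner-marked axis-parallel rectangle of bond-`ℤ²` (`CardyMonotoneApproach.RectCardy`, stmt-5843),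
  given DKKMO's Theorem 2.1 as printed;
* `boxFamilyToCardy_of_thm21SS_of_confInvTransport` — **the crux from its two registered stubs by
  name**: `DKKMO2020_thm21_schrammSmirnov` (printed, unproved: the route's needs-fact debt) and the
  sibling crux `ConfInvTransport` (stmt-CriticalPhenomena-0794, OPEN) — the composition
  `BoxFamilyToCardy_of` of the registered skeleton, over tree theorems only;
* `boxFamilyToCardy_of_thm21SS_of_rectanglesToConformal` — the same with the open half in the
  weaker by-name form `RectCardy → CardyFormulaZ2`.

No new definitions; no named fact is taken as an axiom (both enter as hypotheses).
-/

open Literature.Probability.Percolation (DKKMO2020_thm21_quadCrossingProb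
  DKKMO2020_thm21_schrammSmirnov DKKMO2020_thm21_quadCrossingProb_of_thm21_schrammSmirnov)
open Summit.CriticalPhenomena.CardyFormulaZ2.Theses.CardyWickAnisotropy (AnisotropicBoxCardy
  BoxFamilyToCardy)
open Summit.CriticalPhenomena.CardyFormulaZ2.Theses.CardyMonotoneApproach (RectCardy ConfInvTransport)

namespace Summit.CriticalPhenomena.CardyFormulaZ2.Cruxes.BoxFamilyToCardy.Birth

/-- **The known half of the crux from DKKMO's Theorem 2.1 as printed**: Cardy along the anisotropic
self-dual box family of bond-`ℤ²` (`AnisotropicBoxCardy`) gives Cardy's formula for the crossing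
probabilities of every corner-marked axis-parallel rectangle of isotropic bond-`ℤ²` at `p = 1/2`
(`RectCardy`), given the Schramm–Smirnov half of DKKMO Thm. 2.1 (`q = 1`) — composition of
`DKKMO2020_thm21_quadCrossingProb_of_thm21_schrammSmirnov` (`IsoradialRectangularCrossingsOfSSFact.lean`) with lead c1's `isotropicRectangles_of_thm21` (Cor. 1.3 being
discharged there from the per-quad theorem and Schramm–Smirnov's Lemma 5.1).
[cite: DKKMO2020Rotational, Thm. 2.1 and Cor. 1.3 (q = 1)] -/
theorem isotropicRectangles_of_thm21SS :
    DKKMO2020_thm21_schrammSmirnov → AnisotropicBoxCardy → RectCardy :=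
  fun h hA => isotropicRectangles_of_thm21 (DKKMO2020_thm21_quadCrossingProb_of_thm21_schrammSmirnov h) hA

/-- **The crux from its two registered stubs, by name** (the composition `BoxFamilyToCardy_of` of the
skeleton `Cruxes/BoxFamilyToCardy/Lines/birth.lean`, lead c2): the printed DKKMO Thm. 2.1 (`d_SS`
half, `DKKMO2020_thm21_schrammSmirnov` — known, unproved in the tree) and conformal invariance of
bond-`ℤ²` crossing limits in transport form (`ConfInvTransport` = stmt-CriticalPhenomena-0794 — OPEN)
imply `BoxFamilyToCardy`. [cite: DKKMO2020Rotational, Thm. 2.1 (q = 1)] -/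
theorem boxFamilyToCardy_of_thm21SS_of_confInvTransport (h : DKKMO2020_thm21_schrammSmirnov)
    (hCIT : ConfInvTransport) : BoxFamilyToCardy :=
  boxFamilyToCardy_of_thm21_of_confInvTransport (DKKMO2020_thm21_quadCrossingProb_of_thm21_schrammSmirnov h) hCIT

/-- The same with the open half in the by-name form "Cardy on corner-marked rectangles ⇒ the
conjunct" (`RectCardy → CardyFormulaZ2`, which `ConfInvTransport` implies through the assembly of
route `CardyMonotoneApproach`). [cite: DKKMO2020Rotational, Thm. 2.1 (q = 1)] -/
theorem boxFamilyToCardy_of_thm21SS_of_rectanglesToConformal (h : DKKMO2020_thm21_schrammSmirnov)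
    (hRC : RectCardy → CardyFormulaZ2) : BoxFamilyToCardy :=
  boxFamilyToCardy_of_thm21_of_rectanglesToConformal (DKKMO2020_thm21_quadCrossingProb_of_thm21_schrammSmirnov h) hRC

end Summit.CriticalPhenomena.CardyFormulaZ2.Cruxes.BoxFamilyToCardy.Birth
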